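import Summits.CriticalPhenomena.PercolationContinuityZ3.Theorems.Transplant.Slab111VSearchB
import HarnessLib

/-!
# The routing certificate for `ShapedLinkage 3 (Slab111.hexShadow k)`, II′: the NEED LIST, bundles and the certificate test (executable)

builds on p205010 (kernel theorem, internal audit signed; external expert review pending) — NOT used in this file.  Lane `prim-bschramm`, seat
`prim-bschramm-p2` (gen 35; class C1b; memo `HOME/bschramm/P2-LATTICES.md` §129); helper file (`--supports stmt-CriticalPhenomena-4575 --as helper`).
The executable side of the certificate, continued from «Slab111VSearch»: the RESIDUE MODEL of terminal configurations — statuses of the three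
terminals (`STATUSES`), the model window and cleared-set tests of a reduced block type (`inWinB`, `inWs`, `inWRs`), candidacy of a column/status
for `E` and for `w'` (`ecandSt`, `wcandSt`: an outside neighbour in the window exists in the model), joint realizability of a status triple
(`realizableItem`: the witness conditions of the certified terminals of «HexShadowVRouteData» that do not involve middle levels) — the NEED LIST
`needItems` of a configuration, the summary `planInfo` of a plan (checked, fits, `kmin ≤ KMAX`, served status masks), coverage `coveredI`, the bundle
search `searchBundle`, the certificate test **`certOK`**, and the finite list of configurations `configs` of a type.  Soundness of the residue model
(real terminals give a listed configuration and a needed item) is «Slab111VResid»–«Slab111VNeed»; `certOK ⇒` plans is «Slab111VCover».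
-/

namespace Summit.CriticalPhenomena.PercolationContinuityZ3.Theorems.Transplant

namespace Slab111

namespace Srch

/-! ## Statuses, candidacy, realizability, the need list, bundles -/

/-- The seven statuses. [folklore] -/
def STATUSES : List ℕ := [0, 1, 2, 9, 10, 11, 12]

/-- Window test of a relative column (outside/after-vertices of `γ` lie in the window half-planes). [folklore] -/
def inWinB (K : BKey) (q : Col) : Bool := (K.tD == 3 || decide (q.1 ≤ (K.tD : ℤ))) && (K.sR == 3 || decide (q.1 + q.2 ≤ (K.sR : ℤ)))

/-- Class test: column `c` carries the level of extended status `s` (`s ≤ 3`: bottom level `s`; `10 ≤ s ≤ 13`: top level `k − (12 − s)`; else middle). [folklore] -/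
def hasLevel (C : Ctx) (c : Col) (s : ℤ) : Bool :=
  if s ≤ 3 then (s - C.c0 - lvlC c) % 3 == 0 else if 10 ≤ s then ((C.kr : ℤ) - (12 - s) - C.c0 - lvlC c) % 3 == 0 else true

/-- The vertex of column `c` at extended status `s` lies in `W`. [folklore] -/
def inWs (T : CtxT) (c : Col) (s : ℤ) : Bool :=
  decide (0 ≤ s) && decide (s ≤ 12) && hasLevel T.C c s && inBlkB T.C.K.tD T.C.K.sD c &&
    !(T.hasCodeT c 4 || (s == 0 && T.hasCodeT c 0) || (s == 1 && T.hasCodeT c 1) || (s == 11 && T.hasCodeT c 2) || (s == 12 && T.hasCodeT c 3))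

/-- Same, and over the rerouting block. [folklore] -/
def inWRs (T : CtxT) (c : Col) (s : ℤ) : Bool := inWs T c s && inBlkB T.C.K.tR T.C.K.sR c

/-- Extended status of the level above / below a level of extended status `s`. [folklore] -/
def nbrStatus (s : ℤ) (up : Bool) : ℤ := if s = 9 then 9 else if up = true then (if s = 3 then 9 else s + 1) else (if s = 10 then 9 else s - 1)

/-- **`E`-candidacy in the residue model**: the vertex exists in `W` over the rerouting block, off the centre, and has a neighbour outside `W`
inside the window. [folklore] -/
def ecandSt (T : CtxT) (c : Col) (s : ℕ) : Bool :=
  inWRs T c s && !(c == (0,0)) &&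
    (ups.any fun u =>
      (decide (nbrStatus s true ≤ 12) && inWinB T.C.K (c.1 + u.1, c.2 + u.2) && !inWs T (c.1 + u.1, c.2 + u.2) (nbrStatus s true)) ||
      (decide (0 ≤ nbrStatus s false) && inWinB T.C.K (c.1 - u.1, c.2 - u.2) && !inWs T (c.1 - u.1, c.2 - u.2) (nbrStatus s false)))

/-- `w'`-candidacy: in `W`, off the centre. [folklore] -/
def wcandSt (T : CtxT) (c : Col) (s : ℕ) : Bool := inWs T c s && !(c == (0,0))

/-- Neighbour witnesses `(o, a)` of an exact `E` at extended status `s` (as (column, extended status) pairs): `o` outside `W` in the window,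
`a` in the window, `a ≠ o`, both columns different from the column `c3` of `w'`, `a` not one of the excluded vertices. [folklore] -/
def witnesses (T : CtxT) (c : Col) (s : ℤ) (c3 : Col) (excl : List (Col × ℤ)) : List ((Col × ℤ) × (Col × ℤ)) :=
  let nb : List (Col × ℤ) := ups.flatMap fun u =>
    [((c.1 + u.1, c.2 + u.2), nbrStatus s true), ((c.1 - u.1, c.2 - u.2), nbrStatus s false)]
  let nb := nb.filter fun v => decide (0 ≤ v.2) && decide (v.2 ≤ 12) && inWinB T.C.K v.1
  let os := nb.filter fun v => !inWs T v.1 v.2 && !(v.1 == c3)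
  os.flatMap fun o => (nb.filter fun a => !(a == o) && !(a.1 == c3) && !excl.contains a).map fun a => (o, a)

/-- The joint conditions on two witness pairs `(o₁,a₁)`, `(o₂,a₂)`: `o₁ ≠ o₂`, `o₁ ≠ a₂`, `a₁ ≠ o₂`, and `a₁ = a₂` only over the centre. [folklore] -/
def pairConds (oa1 oa2 : (Col × ℤ) × (Col × ℤ)) : Bool :=
  !(oa1.1 == oa2.1) && !(oa1.1 == oa2.2) && !(oa1.2 == oa2.1) && (!(oa1.2 == oa2.2) || oa1.2.1 == (0,0))

/-- Some pair of witness pairs satisfies the joint conditions. [folklore] -/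
def jointOK (W1 W2 : List ((Col × ℤ) × (Col × ℤ))) : Bool := W1.any fun oa1 => W2.any fun oa2 => pairConds oa1 oa2

/-- Both `E`-statuses are exact and on the same side of the film. [folklore] -/
def bothExactSameSide (s1 s2 : ℕ) : Bool := (s1 != 9) && (s2 != 9) && ((decide (s1 ≤ 2) && decide (s2 ≤ 2)) || (decide (10 ≤ s1) && decide (10 ≤ s2)))

/-- **The witness clause** of realizability of the two `E`-terminals: joint witnesses when both are exact on one side, single witnesses
otherwise (witness columns avoid the column of `w'`). [folklore] -/
def witnessClause (T : CtxT) (c1 c2 c3 : Col) (s1 s2 : ℕ) : Bool :=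
  if bothExactSameSide s1 s2 then
    jointOK (witnesses T c1 s1 c3 [(c2, (s2 : ℤ))]) (witnesses T c2 s2 c3 [(c1, (s1 : ℤ))])
  else (!(s1 != 9) || !(witnesses T c1 s1 c3 []).isEmpty) && (!(s2 != 9) || !(witnesses T c2 s2 c3 []).isEmpty)

/-- **Realizability of a status pair of the two `E`-terminals** (given the column of `w'`). [folklore] -/
def pairOK (T : CtxT) (c1 c2 c3 : Col) (s1 s2 : ℕ) : Bool :=
  ecandSt T c1 s1 && ecandSt T c2 s2 && !(c1 == c2 && s1 == s2 && s1 != 9) && witnessClause T c1 c2 c3 s1 s2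

/-- **Realizability of a status triple in the residue model** (the certified-terminal conditions of «HexShadowVRouteData» that do not involve the
level of a middle terminal). [folklore] -/
def realizableItem (T : CtxT) (c1 c2 c3 : Col) (s1 s2 s3 : ℕ) : Bool :=
  pairOK T c1 c2 c3 s1 s2 && wcandSt T c3 s3 && !(c3 == (0,0)) && !(c3 == c1) && !(c3 == c2)

/-- **The NEED list** of a configuration: all status triples realizable in the residue model. [folklore] -/
def needItems (T : CtxT) (c1 c2 c3 : Col) : List (ℕ × ℕ × ℕ) :=
  let S1 := STATUSES.filter (ecandSt T c1); let S2 := STATUSES.filter (ecandSt T c2); let S3 := STATUSES.filter (wcandSt T c3)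
  let P12 := S1.flatMap fun s1 => S2.filterMap fun s2 => if pairOK T c1 c2 c3 s1 s2 then some (s1, s2) else none
  if (c3 == (0,0)) || (c3 == c1) || (c3 == c2) then [] else P12.flatMap fun p => S3.map fun s3 => (p.1, p.2, s3)

/-- A stack item (same column, both middle). [folklore] -/
def isStackItem (c1 c2 : Col) (it : ℕ × ℕ × ℕ) : Bool := (c1 == c2) && (it.1 == 9) && (it.2.1 == 9)

/-- The plan is of stack kind with the given orientation (`some low`), or not of stack kind (`none`). [folklore] -/
def stkIs (P : PlanD) : Option Bool := match P.kind with | Kind.stk _ l => some l | _ => none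

/-- Summary of a plan for a context and configuration: usable? (checked, fits the columns, `kmin ≤ KMAX`), the stack orientation, and the three
13-bit masks of served statuses. [folklore] -/
def planInfo (T : CtxT) (c1 c2 c3 : Col) (P : PlanD) : Bool × Option Bool × ℕ × ℕ × ℕ :=
  let m (t : TermD) : ℕ := STATUSES.foldl (fun acc s => if t.allowsT T P.kind s then acc ||| bit s else acc) 0
  (P.checkT T && P.fits c1 c2 c3 && decide (P.kmin ≤ KMAX), stkIs P, m P.t1, m P.t2, m P.t3a &&& m P.t3b)

/-- **An item is covered** (given the plan summaries): a checked non-stack plan serving the triple, or checked stack plans of both orientations. [folklore] -/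
def coveredI (c1 c2 : Col) (I : List (Bool × Option Bool × ℕ × ℕ × ℕ)) (it : ℕ × ℕ × ℕ) : Bool :=
  let srv (x : Bool × Option Bool × ℕ × ℕ × ℕ) : Bool := x.1 && hasBit x.2.2.1 it.1 && hasBit x.2.2.2.1 it.2.1 && hasBit x.2.2.2.2 it.2.2
  if isStackItem c1 c2 it then (I.any fun x => x.2.1 == some true && srv x) && (I.any fun x => x.2.1 == some false && srv x)
  else I.any fun x => x.2.1 == none && srv x

/-- The nine residue contexts of a type (the contexts `Ctx.of K c0 kr`, spelled out computably). [folklore] -/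
def sctxs (K : BKey) : List SCtx :=
  [0,1,2].flatMap fun c0 => [0,1,2].map fun kr => SCtx.of ⟨K, c0, kr, peelTab K.tR K.tD K.sR K.sD c0 kr⟩

/-- **Bundle search** for one configuration over the given residue contexts: a free plan, then — per residue — what the need list still wants. [folklore] -/
def searchBundle (SS : List SCtx) (c1 c2 c3 : Col) : List PlanD :=
  match SS with
  | [] => []
  | S0 :: _ =>
  let base : List PlanD := if c1 == c2 then [] else (match searchFree S0 c1 c2 c3 (9, 9, 9) 0 with | some P => [P] | none => [])
  SS.foldl (fun B S =>
    let T := S.T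
    let I0 := B.map (planInfo T c1 c2 c3)
    ((needItems T c1 c2 c3).foldl (fun BI it =>
      let (B, I) := BI
      if coveredI c1 c2 I it then (B, I) else
      let (s1, s2, s3) := it
      let found : List PlanD :=
        if isStackItem c1 c2 it then
          match searchStack S c1 c3 true s3, searchStack S c1 c3 false s3 with
          | some P, some Q => [P, Q]
          | _, _ => []
        else
          let f1 : List PlanD := if c1 == c2 then [] else (match searchFree S c1 c2 c3 it (if s1 == 9 && s2 == 9 then 0 else 1) with
            | some P => [P] | none => [])
          if !f1.isEmpty then f1 else
          let tryB := if s1 ≤ 2 || s2 ≤ 2 || s3 ≤ 2 then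
              firstSome ([0,1,2,3,4,5].filter fun e => e % 3 == T.C.c0) fun e => searchAnchored S c1 c2 c3 s1 s2 s3 true e else none
          match tryB with
          | some P => [P]
          | none =>
            let tryT := if 10 ≤ s1 || 10 ≤ s2 || 10 ≤ s3 then
                firstSome ([2,3,4,5,6,7].filter fun m => ((T.C.kr : ℤ) - m - T.C.c0) % 3 == 0) fun m => searchAnchored S c1 c2 c3 s1 s2 s3 false m else none
            match tryT with | some P => [P] | none => []
      (B ++ found, I ++ found.map (planInfo T c1 c2 c3))) (B, I0)).1) base

/-- **The certificate test of one configuration**: every needed item of every residue is covered by the bundle. [folklore] -/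
def certOK (SS : List SCtx) (c1 c2 c3 : Col) : Bool :=
  let B := searchBundle SS c1 c2 c3
  SS.all fun S => match needItems S.T c1 c2 c3 with
    | [] => true
    | items => let I := B.map (planInfo S.T c1 c2 c3); items.all (coveredI c1 c2 I)

/-- Candidate `E`-columns of a type (some status is an `E`-candidate for some residue). [folklore] -/
def eCols (SS : List SCtx) : List Col := hexCols.filter fun c => SS.any fun S => STATUSES.any (ecandSt S.T c)

/-- Candidate `w'`-columns. [folklore] -/
def wCols (SS : List SCtx) : List Col := hexCols.filter fun c => SS.any fun S => STATUSES.any (wcandSt S.T c)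

/-- Excluded column triples: `w'` over the centre or over the column of `E₁` or `E₂`. [folklore] -/
def excluded (c1 c2 c3 : Col) : Bool := c3 == (0,0) || c3 == c1 || c3 == c2

/-- All configurations of a type (for evaluation tooling). [folklore] -/
def configs (SS : List SCtx) : List (Col × Col × Col) :=
  (eCols SS).flatMap fun c1 => (eCols SS).flatMap fun c2 => (wCols SS).filterMap fun c3 =>
    if excluded c1 c2 c3 then none else some (c1, c2, c3)

/-- **One row of the certificate**: all configurations with `E₁` over the `i`-th candidate column pass `certOK`.  (Nested enumeration over the
candidate lists, so that the kernel sees literally equal column terms in every configuration and shares all per-column and per-pair work.) [folklore] -/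
def certRow (SS : List SCtx) (i : ℕ) : Bool :=
  match (eCols SS)[i]? with
  | none => true
  | some c1 => (eCols SS).all fun c2 => (wCols SS).all fun c3 => excluded c1 c2 c3 || certOK SS c1 c2 c3

/-- **The certificate of a block type**: every row passes. [folklore] -/
def certAllB (K : BKey) : Bool := (List.range (eCols (sctxs K)).length).all (certRow (sctxs K))

end Srch

end Slab111

end Summit.CriticalPhenomena.PercolationContinuityZ3.Theorems.Transplant
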